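import Summits.ResolutionOfSingularities.ResolutionOfSingularities.Theorems.EquisingularLiftEquisingularLiftNatExactShadowPlanar
import Summits.ResolutionOfSingularities.ResolutionOfSingularities.Theorems.EquisingularLiftEquisingularLiftNatSingularPointDescends
import Summits.ResolutionOfSingularities.ResolutionOfSingularities.Theorems.EquisingularLiftEquisingularLiftNatNonCartierFibre
import HarnessLib

/-!
# [OURS · L1 W4.5(b) · EL♮(3)] E-NEG(1), part 2 — an exact shadow with zero-dimensional fibre over `q` forces the section INTO the
# shadow's image: the restricted centre `ker s · 𝒪_{D♭, q}` is never a quasi-regular pair (conclusion (iii) of PLANNER-MEMO-g9-1 v1.1,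
# modulo its local input; crux `EquisingularLiftNatThree` = stmt-ResolutionOfSingularities-20148, parent stmt-20038)

NOT a statement of any manuscript. Helper file of the chain res-L1-w45b (cell `res-hironaka`, rung L, slot W4.5(b)); AI-written, weaker than
expert review; filed `--supports stmt-ResolutionOfSingularities-20148 --as helper`; it closes nothing. Object (O1) E-NEG(1) of res-L1-w45b-plan-1's
PLANNER-MEMO-g9-1 (negative companion of the rungs v7′ / T-PROX; not load-bearing for `closes`). Continuation of part 1
(`…NatExactShadowPlanar`, p528211: (i) planarity, (ii) `supp C = St_s(D♭)`).

SETTING (as part 1). `O` a DVR, `r : P → Spec O` proper (`P` integral, locally Noetherian), `τ₁ : X₁ → P`, `s : Spec O → X₁`, `τ : X₂ → X₁` the blow-up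
along `ker s`, `Γ ⊆ X₁` with `Γ ∖ supp ker s` infinite, `C` an ideal sheaf on `X₂` with `V(C)` integral whose special fibre is the set-level strict
transform `closure τ⁻¹(Γ ∖ supp ker s)`; `D♭ := τ(supp C)` (closed, part 1), `V(D♭)_red` its reduced closed subscheme, `ι` the inclusion.

CONTENT.
* `exists_specializes_ne_fibre_of_exactShadow` — T-FIBRE transported: if at a point `z` of `V(D♭)_red` the restricted centre
  `(ker s · 𝒪_{V(D♭)_red})_z` is generated by a QUASI-REGULAR sequence of length `≥ 2` in `𝔪_z` (the «Cohen–Macaulay, 𝔪-primary, two generators» input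
  of PLANNER-MEMO-g9-1 §1 (c1)), then the fibre of `supp C` over `ι z` contains two distinct points `c₁ ⤳ c₀` (res-D-pv-003's
  `exists_specializes_ne_of_isQuasiRegular` on the blow-up `V(supp C)_red = St_s(D♭)_red → V(D♭)_red` of `exists_isBlowup_reducedStrictTransform_closed`,
  p526913, + part 1 (ii)).
* **`not_isQuasiRegular_centre_of_exactShadow`** — hence, if the fibre of `supp C` over `q` is ZERO-DIMENSIONAL («no two distinct points `c₁ ⤳ c₀` of
  `supp C` over `q`» — the kernel spelling of PLANNER-MEMO-g9-1's «`Γ̃ ∩ e_q` finite», valid without finite-type hypotheses), NO such quasi-regular pair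
  exists at the point of `D♭` under `q`: the section `s` is NOT transversal to `D♭` at `q` — conclusion (iii) «`s ⊆ D♭`» modulo the local dictionary
  «`s(η) ∉ D♭` ⇒ `(ker s)·𝒪_{D♭,q}` is an `𝔪_q`-primary system of parameters of the CM surface germ `𝒪_{E,q}/(g̃)`» (part 3, frame currency).
* `closedPoint_mem_image_support_of_exactShadow` — `q ∈ D♭` as soon as `q ∈ closure (Γ ∖ {q})` (Γ a curve through `q`).
* `range_subset_image_support_of_exactShadow` — (iii) in final form from the conditional local input: if `s(η) ∉ D♭` would produce the quasi-regular
  pair, then `s(Spec O) ⊆ D♭`.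

References: H. Matsumura, *Commutative Ring Theory* (1986), Thms. 14.5, 16.2, 17.4; The Stacks Project, Tags 080E, 0804 — through the cited tree files.
OURS planning text (index only): L/w45b/PLANNER-MEMO-g9-1.md v1.1.
-/

set_option linter.dupNamespace false -- mandated namespace `Summit.<Summit>.<Problem>` of this single-conjunct summit
set_option linter.overlappingInstances false -- signatures carry `[IsDomain O] [IsDiscreteValuationRing O]`

open CategoryTheory AlgebraicGeometry TopologicalSpace Topology IsLocalRing
open AlgebraicGeometry.Scheme.IdealSheafData Literature.AlgebraicGeometry.Resolution

namespace Summit.ResolutionOfSingularities.ResolutionOfSingularities.Cruxes.EquisingularLiftNat.Sections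

section ExactShadowSection

variable {O : Type} [CommRing O] [IsDomain O] [IsDiscreteValuationRing O] {P X₁ X₂ : Scheme.{0}}
  [IsLocallyNoetherian X₁] [IsLocallyNoetherian X₂]

/-- **T-FIBRE transported to an exact shadow.** In the SETTING, let `z` be a point of `V(D♭)_red` at which the restricted centre
`(ker s)·𝒪_{V(D♭)_red, z}` is generated by a quasi-regular sequence `c` of length `≥ 2` inside `𝔪_z`. Then the fibre of `supp C` over `ι z`
contains two DISTINCT points `c₁ ⤳ c₀`. [cite: Matsumura1987, Thm. 14.5; StacksProject, Tag 080E] [OURS · L1 W4.5b] -/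
theorem exists_specializes_ne_fibre_of_exactShadow (r : P ⟶ Spec (.of O)) (τ₁ : X₁ ⟶ P) (s : Spec (.of O) ⟶ X₁)
    (τ : X₂ ⟶ X₁) (hτ : IsBlowup τ s.ker) (Γ : Set X₁) (hΓinf : (Γ \ (s.ker.support : Set X₁)).Infinite)
    (C : X₂.IdealSheafData) (hCint : IsIntegral C.subscheme)
    (hCsp : (C.support : Set X₂) ∩ (CategoryStruct.comp τ (CategoryStruct.comp τ₁ r)) ⁻¹' {closedPoint O} =
      closure (τ ⁻¹' (Γ \ (s.ker.support : Set X₁))))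
    (hD : IsClosed (τ '' (C.support : Set X₂))) (z : ↥(vanishingIdeal (⟨τ '' (C.support : Set X₂), hD⟩ : Closeds X₁)).subscheme)
    {n : ℕ} (c : Fin (n + 2) → (vanishingIdeal (⟨τ '' (C.support : Set X₂), hD⟩ : Closeds X₁)).subscheme.presheaf.stalk z)
    (hc : Ideal.span (Set.range c) =
      stalkIdeal (s.ker.comap (vanishingIdeal (⟨τ '' (C.support : Set X₂), hD⟩ : Closeds X₁)).subschemeι) z)
    (hcq : IsQuasiRegular c) (hcm : ∀ l, c l ∈ maximalIdeal _) :
    ∃ c₁ c₀ : X₂, c₁ ∈ (C.support : Set X₂) ∧ c₀ ∈ (C.support : Set X₂) ∧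
      τ c₁ = (vanishingIdeal (⟨τ '' (C.support : Set X₂), hD⟩ : Closeds X₁)).subschemeι z ∧
      τ c₀ = (vanishingIdeal (⟨τ '' (C.support : Set X₂), hD⟩ : Closeds X₁)).subschemeι z ∧ c₁ ≠ c₀ ∧ c₁ ⤳ c₀ := by
  haveI : IsProper τ := hτ.isProper
  set ι₁ := (vanishingIdeal (⟨τ '' (C.support : Set X₂), hD⟩ : Closeds X₁)).subschemeι with hι₁
  -- the reduced strict transform `V(supp C)_red → V(D♭)_red` is the blow-up along the restricted centre
  obtain ⟨ρ, hρι, -, hρb⟩ :=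
    exists_isBlowup_reducedStrictTransform_closed X₁ X₂ τ s.ker hτ (τ '' (C.support : Set X₂)) hD
  set ι₂ := (vanishingIdeal (⟨closure (τ ⁻¹' (τ '' (C.support : Set X₂) \ (s.ker.support : Set X₁))), isClosed_closure⟩ :
    Closeds X₂)).subschemeι with hι₂
  -- part 1 (ii): `supp C` IS that strict transform
  have hSt : (C.support : Set X₂) = closure (τ ⁻¹' (τ '' (C.support : Set X₂) \ (s.ker.support : Set X₁))) :=
    (support_eq_strictTransform_image_of_exactShadow r τ₁ s τ hτ Γ hΓinf C hCint hCsp).2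
  have hrange : Set.range ι₂ = closure (τ ⁻¹' (τ '' (C.support : Set X₂) \ (s.ker.support : Set X₁))) := by
    rw [hι₂, ComponentGluing.range_subschemeι_vanishingIdeal]
    rfl
  have hmemC : ∀ t, ι₂ t ∈ (C.support : Set X₂) := fun t => by
    have h1 : ι₂ t ∈ Set.range ι₂ := ⟨t, rfl⟩
    rw [hrange] at h1
    rw [Set.ext_iff] at hSt
    exact (hSt _).mpr h1
  -- T-FIBRE on `ρ`
  obtain ⟨x₁, x₀, hx₁, hx₀, hne, hsp⟩ := exists_specializes_ne_of_isQuasiRegular hρb z c hc hcq hcm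
  have hτι : ∀ t, ρ t = z → τ (ι₂ t) = ι₁ z := fun t ht => by
    rw [← Scheme.Hom.comp_apply, ← hρι, Scheme.Hom.comp_apply, ht]
  exact ⟨ι₂ x₁, ι₂ x₀, hmemC x₁, hmemC x₀, hτι x₁ hx₁, hτι x₀ hx₀, fun h => hne (ι₂.isClosedEmbedding.injective h),
    hsp.map ι₂.continuous⟩

/-- **E-NEG(1) (iii), kernel form — the restricted centre at the point under `q` is never a quasi-regular pair.** In the SETTING, suppose the
fibre of `supp C` over `q = s(s₀)` is ZERO-DIMENSIONAL: no two distinct points `c₁ ⤳ c₀` of `supp C` lie over `q`. Then at the point `z` of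
`V(D♭)_red` under `q`, the restricted centre `(ker s)·𝒪_{V(D♭)_red, z}` is NOT generated by a quasi-regular sequence of length `≥ 2` inside `𝔪_z`
(«`s` is not transversal to `D♭` at `q`»; with the Cohen–Macaulay dictionary of part 3 this is «`s(η) ∈ D♭`»).
[cite: Matsumura1987, Thm. 14.5; StacksProject, Tag 080E] [OURS · L1 W4.5b] -/
theorem not_isQuasiRegular_centre_of_exactShadow (r : P ⟶ Spec (.of O)) (τ₁ : X₁ ⟶ P) (s : Spec (.of O) ⟶ X₁)
    (τ : X₂ ⟶ X₁) (hτ : IsBlowup τ s.ker) (Γ : Set X₁) (hΓinf : (Γ \ (s.ker.support : Set X₁)).Infinite)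
    (C : X₂.IdealSheafData) (hCint : IsIntegral C.subscheme)
    (hCsp : (C.support : Set X₂) ∩ (CategoryStruct.comp τ (CategoryStruct.comp τ₁ r)) ⁻¹' {closedPoint O} =
      closure (τ ⁻¹' (Γ \ (s.ker.support : Set X₁))))
    (hfib : ∀ c₁ c₀ : X₂, c₁ ∈ (C.support : Set X₂) → c₀ ∈ (C.support : Set X₂) → τ c₁ = s (closedPoint O) →
      τ c₀ = s (closedPoint O) → c₁ ⤳ c₀ → c₁ = c₀)
    (hD : IsClosed (τ '' (C.support : Set X₂))) (z : ↥(vanishingIdeal (⟨τ '' (C.support : Set X₂), hD⟩ : Closeds X₁)).subscheme)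
    (hz : (vanishingIdeal (⟨τ '' (C.support : Set X₂), hD⟩ : Closeds X₁)).subschemeι z = s (closedPoint O))
    {n : ℕ} (c : Fin (n + 2) → (vanishingIdeal (⟨τ '' (C.support : Set X₂), hD⟩ : Closeds X₁)).subscheme.presheaf.stalk z)
    (hc : Ideal.span (Set.range c) =
      stalkIdeal (s.ker.comap (vanishingIdeal (⟨τ '' (C.support : Set X₂), hD⟩ : Closeds X₁)).subschemeι) z)
    (hcm : ∀ l, c l ∈ maximalIdeal _) : ¬ IsQuasiRegular c := by
  intro hcq
  obtain ⟨c₁, c₀, h₁, h₀, hτ₁, hτ₀, hne, hsp⟩ :=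
    exists_specializes_ne_fibre_of_exactShadow r τ₁ s τ hτ Γ hΓinf C hCint hCsp hD z c hc hcq hcm
  rw [hz] at hτ₁ hτ₀
  exact hne (hfib c₁ c₀ h₁ h₀ hτ₁ hτ₀ hsp)

omit [IsLocallyNoetherian X₂] in
/-- **`q ∈ D♭`.** If the closed point `q = s(s₀)` of the section lies in the closure of `Γ ∖ supp ker s` (e.g. `Γ` a curve through `q`), then
`q ∈ D♭ = τ(supp C)`. [folklore] [OURS · L1 W4.5b] -/
theorem closedPoint_mem_image_support_of_exactShadow (r : P ⟶ Spec (.of O)) (τ₁ : X₁ ⟶ P) (s : Spec (.of O) ⟶ X₁)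
    (τ : X₂ ⟶ X₁) (hτ : IsBlowup τ s.ker) (Γ : Set X₁) (C : X₂.IdealSheafData)
    (hCsp : (C.support : Set X₂) ∩ (CategoryStruct.comp τ (CategoryStruct.comp τ₁ r)) ⁻¹' {closedPoint O} =
      closure (τ ⁻¹' (Γ \ (s.ker.support : Set X₁))))
    (hq : s (closedPoint O) ∈ closure (Γ \ (s.ker.support : Set X₁))) :
    s (closedPoint O) ∈ τ '' (C.support : Set X₂) := by
  -- `τ(Γ̃) = closure τ(τ⁻¹(Γ ∖ supp ker s)) = closure (Γ ∖ supp ker s)` (onto off the centre)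
  have himg : τ '' (τ ⁻¹' (Γ \ (s.ker.support : Set X₁))) = Γ \ (s.ker.support : Set X₁) := by
    refine Set.Subset.antisymm (Set.image_preimage_subset _ _) fun y hy => ?_
    obtain ⟨c, hc⟩ := exists_preimage_of_not_mem_support τ s.ker hτ hy.2
    exact ⟨c, by rw [Set.mem_preimage, hc]; exact hy, hc⟩
  have h1 : s (closedPoint O) ∈ τ '' closure (τ ⁻¹' (Γ \ (s.ker.support : Set X₁))) := by
    rw [image_closure_eq_of_isBlowup τ s.ker hτ, himg]
    exact hq
  rw [← hCsp] at h1
  obtain ⟨c, ⟨hc, -⟩, hcq⟩ := h1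
  exact ⟨c, hc, hcq⟩

omit [IsLocallyNoetherian X₁] [IsLocallyNoetherian X₂] in
/-- The prime spectrum of a DVR has two points: the generic point `η = (0)` and the closed point. [folklore] -/
theorem eq_closedPoint_or_eq_bot (u : Spec (.of O)) :
    u = closedPoint O ∨ u = (⟨⊥, Ideal.isPrime_bot⟩ : Spec (.of O)) := by
  by_cases h : u.asIdeal = ⊥
  · exact Or.inr (PrimeSpectrum.ext h)
  · left
    apply PrimeSpectrum.ext
    change u.asIdeal = maximalIdeal O
    exact IsLocalRing.eq_maximalIdeal (IsPrime.to_maximal_ideal (S := u.asIdeal) h)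

/-- **E-NEG(1) (iii) — `s(Spec O) ⊆ D♭`, from the conditional local input.** In the SETTING with a zero-dimensional fibre of `supp C` over `q`
and `q ∈ closure (Γ ∖ {q})`: IF the absence of the generic point `s(η)` from `D♭` would make the restricted centre at the point under `q` a
quasi-regular pair in `𝔪` (the Cohen–Macaulay dictionary of PLANNER-MEMO-g9-1 §1 (c1), part 3), THEN the whole section lies in `D♭`:
`s(Spec O) ⊆ τ(supp C)`. [cite: Matsumura1987, Thm. 14.5; StacksProject, Tag 080E] [OURS · L1 W4.5b] -/
theorem range_subset_image_support_of_exactShadow (r : P ⟶ Spec (.of O)) (τ₁ : X₁ ⟶ P) (s : Spec (.of O) ⟶ X₁)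
    (τ : X₂ ⟶ X₁) (hτ : IsBlowup τ s.ker) (Γ : Set X₁) (hΓinf : (Γ \ (s.ker.support : Set X₁)).Infinite)
    (C : X₂.IdealSheafData) (hCint : IsIntegral C.subscheme)
    (hCsp : (C.support : Set X₂) ∩ (CategoryStruct.comp τ (CategoryStruct.comp τ₁ r)) ⁻¹' {closedPoint O} =
      closure (τ ⁻¹' (Γ \ (s.ker.support : Set X₁))))
    (hfib : ∀ c₁ c₀ : X₂, c₁ ∈ (C.support : Set X₂) → c₀ ∈ (C.support : Set X₂) → τ c₁ = s (closedPoint O) →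
      τ c₀ = s (closedPoint O) → c₁ ⤳ c₀ → c₁ = c₀)
    (hq : s (closedPoint O) ∈ closure (Γ \ (s.ker.support : Set X₁)))
    (hD : IsClosed (τ '' (C.support : Set X₂)))
    (hloc : s (⟨⊥, Ideal.isPrime_bot⟩ : Spec (.of O)) ∉ τ '' (C.support : Set X₂) →
      ∃ (z : ↥(vanishingIdeal (⟨τ '' (C.support : Set X₂), hD⟩ : Closeds X₁)).subscheme)
        (_ : (vanishingIdeal (⟨τ '' (C.support : Set X₂), hD⟩ : Closeds X₁)).subschemeι z = s (closedPoint O))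
        (n : ℕ) (c : Fin (n + 2) → (vanishingIdeal (⟨τ '' (C.support : Set X₂), hD⟩ : Closeds X₁)).subscheme.presheaf.stalk z),
        Ideal.span (Set.range c) =
          stalkIdeal (s.ker.comap (vanishingIdeal (⟨τ '' (C.support : Set X₂), hD⟩ : Closeds X₁)).subschemeι) z ∧
        (∀ l, c l ∈ maximalIdeal _) ∧ IsQuasiRegular c) :
    Set.range s ⊆ τ '' (C.support : Set X₂) := by
  have hη : s (⟨⊥, Ideal.isPrime_bot⟩ : Spec (.of O)) ∈ τ '' (C.support : Set X₂) := by
    by_contra hnot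
    obtain ⟨z, hz, n, c, hc, hcm, hcq⟩ := hloc hnot
    exact not_isQuasiRegular_centre_of_exactShadow r τ₁ s τ hτ Γ hΓinf C hCint hCsp hfib hD z hz c hc hcm hcq
  rintro _ ⟨u, rfl⟩
  rcases eq_closedPoint_or_eq_bot u with h | h
  · rw [h]; exact closedPoint_mem_image_support_of_exactShadow r τ₁ s τ hτ Γ C hCsp hq
  · rw [h]; exact hη

end ExactShadowSection

end Summit.ResolutionOfSingularities.ResolutionOfSingularities.Cruxes.EquisingularLiftNat.Sections
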